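import Summits.RiemannHypothesis.RiemannHypothesis.Theorems.LiPrimeEchoWindowAdjust
import Summits.RiemannHypothesis.RiemannHypothesis.Theorems.LiTailLaguerreFejerAngle
import Literature.Analysis.Fourier.VanDerCorput
import HarnessLib

/-!
# RiemannHypothesis / LiPrimeEcho — the SMOOTH WINDOW BOUND is a theorem (RH-FREE)

RH-FREE [rh-li-eng-4].  Cell `pub/rh-li`; PART D (`Theorems/LiPrimeEchoDefs.lean`) types, next to the PROVED rung leaf
«Li PRIME-ECHO LAW» `LiZeroWindowEcho` (`liZeroWindowEcho_proof`), two companions left open by round 6: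

* `LiSmoothTraceWindowBound` (support-size target): for fixed `c ≥ 1`, `|(2/π)∫_{√n}^{c√n} cos(nθ(t)) ϑ'(t) dt| ≤ C_c log n`;
* `LiZeroWindowEchoBare` (T3d⁻): «the zeros of height `(√n, c√n]` ALONE chirp the prime `2`»,
  `|Σ_{√n<|Im ρ|≤c√n} Re m_ρ(1 − 1/ρ)ⁿ + E₂(n)| ≤ C_c log² n` for `c ≥ 5/4`.

This module proves the first (the second follows in `Theorems/LiPrimeEchoWindowEchoBare.lean`):
`liSmoothTraceWindowBound_holds` by the FIRST-DERIVATIVE TEST with amplitude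
(`SmoothWindow.norm_integral_mul_exp_I_le_of_deriv_le`: if `φ' ≤ −λ < 0` with `φ''` of constant sign and `g ∈ C¹[a, b]`,
then `|∫_a^b g e^{iφ}| ≤ (2/λ)(|g(b)| + ∫_a^b |g'|)`, one integration by parts on the tree's
`Literature.Analysis.Fourier.norm_integral_exp_I_mul_le_of_deriv_le`) applied to the phase `nθ(t)`
(`θ' = −4/(1 + 4t²) ≤ −4/(1 + 4c²)` on `[√n, c√n]`, `θ'' ≥ 0`; smooth angle and derivatives from `Fejer.angS`, rh-li-eng g6)
and the amplitude `½ log(t/2π)`, the remainder `|ϑ' − ½ log(t/2π)| ≤ 2/t` (`abs_riemannSiegelThetaDeriv_sub_log_le`) being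
integrated trivially.  No route file is imported (theses-cone hygiene).  Nothing here bears on the truth of RH: an RH-free
statement about a smooth oscillatory integral.
-/

noncomputable section

-- D-0017: `Summit.<S>.<S>.…` is the designed namespace of a single-problem summit.
set_option linter.dupNamespace false

open Complex MeasureTheory intervalIntegral Set
open scoped Real Interval

namespace Summit.RiemannHypothesis.RiemannHypothesis.Theorems.LiTheory

open Literature.NumberTheory.LFunctions Literature.Analysis.Fourier

namespace SmoothWindow

/-- **First-derivative test with a `C¹` amplitude.**  If `φ ∈ C¹(ℝ)`, `φ' ≤ −λ < 0` on `[a, b]` with `φ''` continuous of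
constant sign there, and `g ∈ C¹[a, b]` (real), then `‖∫_a^b g e^{iφ}‖ ≤ (2/λ)(|g(b)| + ∫_a^b |g'|)`: integrate by parts
against `E(ξ) = ∫_a^ξ e^{iφ}`, `|E| ≤ 2/λ` (`norm_integral_exp_I_mul_le_of_deriv_le`). -/
theorem norm_integral_mul_exp_I_le_of_deriv_le {g g' φ φ' φ'' : ℝ → ℝ} {a b lam : ℝ} (hab : a ≤ b)
    (hlam : 0 < lam) (hφg : ∀ x, HasDerivAt φ (φ' x) x)
    (hφ' : ∀ x ∈ Icc a b, HasDerivAt φ' (φ'' x) x) (hφ''c : ContinuousOn φ'' (Icc a b))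
    (hsign : (∀ x ∈ Icc a b, 0 ≤ φ'' x) ∨ (∀ x ∈ Icc a b, φ'' x ≤ 0))
    (hle : ∀ x ∈ Icc a b, φ' x ≤ -lam)
    (hg : ∀ x ∈ Icc a b, HasDerivAt g (g' x) x) (hg'c : ContinuousOn g' (Icc a b)) :
    ‖∫ x in a..b, (g x : ℂ) * Complex.exp (I * φ x)‖ ≤ 2 / lam * (|g b| + ∫ x in a..b, |g' x|) := by
  have huIcc : uIcc a b = Icc a b := uIcc_of_le hab
  -- `e^{iφ}` is continuous on `ℝ`
  have hfc : Continuous fun y ↦ Complex.exp (I * φ y) := by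
    have hc : Continuous φ := continuous_iff_continuousAt.2 fun x ↦ (hφg x).continuousAt
    exact Complex.continuous_exp.comp (continuous_const.mul (Complex.continuous_ofReal.comp hc))
  -- the primitive `E ξ = ∫_a^ξ e^{iφ}`, its derivative and its bound
  set E : ℝ → ℂ := fun ξ ↦ ∫ y in a..ξ, Complex.exp (I * φ y) with hE
  have hEd : ∀ ξ ∈ uIcc a b, HasDerivAt E (Complex.exp (I * φ ξ)) ξ := fun ξ _ ↦
    (hfc.integral_hasStrictDerivAt a ξ).hasDerivAt
  have hEbound : ∀ ξ ∈ Icc a b, ‖E ξ‖ ≤ 2 / lam := by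
    intro ξ hξ
    have hsub : Icc a ξ ⊆ Icc a b := Icc_subset_Icc le_rfl hξ.2
    refine norm_integral_exp_I_mul_le_of_deriv_le hξ.1 hlam (fun x _ ↦ hφg x)
      (fun x hx ↦ hφ' x (hsub hx)) (hφ''c.mono hsub) ?_ fun x hx ↦ hle x (hsub hx)
    rcases hsign with h | h
    · exact Or.inl fun x hx ↦ h x (hsub hx)
    · exact Or.inr fun x hx ↦ h x (hsub hx)
  have hEa : E a = 0 := by simp [hE]
  -- integration by parts
  have hgc : ContinuousOn g (Icc a b) := fun x hx ↦ (hg x hx).continuousAt.continuousWithinAt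
  have hu : ∀ x ∈ uIcc a b, HasDerivAt (fun x ↦ (g x : ℂ)) ((g' x : ℂ)) x := fun x hx ↦
    (hg x (huIcc ▸ hx)).ofReal_comp
  have hg'i : IntervalIntegrable (fun x ↦ (g' x : ℂ)) volume a b := by
    refine ContinuousOn.intervalIntegrable ?_
    rw [huIcc]
    exact Complex.continuous_ofReal.comp_continuousOn hg'c
  have hfi : IntervalIntegrable (fun y ↦ Complex.exp (I * φ y)) volume a b := hfc.intervalIntegrable a b
  have hparts := intervalIntegral.integral_mul_deriv_eq_deriv_mul hu hEd hg'i hfi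
  rw [hEa, mul_zero, sub_zero] at hparts
  rw [hparts]
  -- `‖g b E b − ∫ g' E‖ ≤ |g b| (2/λ) + ∫ |g'| (2/λ)`
  have hEc : ContinuousOn E (Icc a b) := fun ξ hξ ↦ (hEd ξ (huIcc ▸ hξ)).continuousAt.continuousWithinAt
  have hg'ri : IntervalIntegrable (fun x ↦ |g' x|) volume a b := by
    refine ContinuousOn.intervalIntegrable ?_
    rw [huIcc]
    exact hg'c.abs
  have h1 : ‖(g b : ℂ) * E b‖ ≤ |g b| * (2 / lam) := by
    rw [norm_mul, Complex.norm_real, Real.norm_eq_abs]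
    exact mul_le_mul_of_nonneg_left (hEbound b ⟨hab, le_rfl⟩) (abs_nonneg _)
  have h2 : ‖∫ x in a..b, (g' x : ℂ) * E x‖ ≤ ∫ x in a..b, |g' x| * (2 / lam) := by
    refine intervalIntegral.norm_integral_le_of_norm_le hab ?_ (hg'ri.mul_const _)
    refine Filter.Eventually.of_forall fun x hx ↦ ?_
    have hx' : x ∈ Icc a b := ⟨hx.1.le, hx.2⟩
    rw [norm_mul, Complex.norm_real, Real.norm_eq_abs]
    exact mul_le_mul_of_nonneg_left (hEbound x hx') (abs_nonneg _)
  rw [intervalIntegral.integral_mul_const] at h2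
  calc ‖(g b : ℂ) * E b - ∫ x in a..b, (g' x : ℂ) * E x‖
      ≤ ‖(g b : ℂ) * E b‖ + ‖∫ x in a..b, (g' x : ℂ) * E x‖ := norm_sub_le _ _
    _ ≤ |g b| * (2 / lam) + (∫ x in a..b, |g' x|) * (2 / lam) := add_le_add h1 h2
    _ = 2 / lam * (|g b| + ∫ x in a..b, |g' x|) := by ring

/-- The real oscillatory integral is the real part of the complex one: for `0 < a ≤ b`,
`∫_a^b cos(nθ(t)) g(t) dt = Re ∫_a^b g(t) e^{i n ϑ(t)} dt` (`ϑ = Fejer.angS = θ` on `t > 0`). -/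
theorem integral_cos_mul_eq_re (n : ℕ) {g : ℝ → ℝ} {a b : ℝ} (ha : 0 < a) (hab : a ≤ b)
    (hgc : ContinuousOn g (Icc a b)) :
    ∫ t in a..b, Real.cos (n * liZeroAngle t) * g t =
      (∫ t in a..b, (g t : ℂ) * Complex.exp (I * ((n : ℝ) * Fejer.angS t : ℝ))).re := by
  have hφc : Continuous fun t : ℝ ↦ ((n : ℝ) * Fejer.angS t : ℝ) :=
    continuous_const.mul (continuous_iff_continuousAt.2 fun x ↦ (Fejer.hasDerivAt_angS x).continuousAt)
  have hi : IntervalIntegrable (fun t ↦ (g t : ℂ) * Complex.exp (I * ((n : ℝ) * Fejer.angS t : ℝ)))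
      volume a b := by
    refine ContinuousOn.intervalIntegrable ?_
    rw [uIcc_of_le hab]
    exact (Complex.continuous_ofReal.comp_continuousOn hgc).mul
      ((Complex.continuous_exp.comp (continuous_const.mul (Complex.continuous_ofReal.comp hφc))).continuousOn)
  have hcomm := ContinuousLinearMap.intervalIntegral_comp_comm Complex.reCLM hi
  simp only [Complex.reCLM_apply] at hcomm
  rw [← hcomm]
  refine intervalIntegral.integral_congr fun t ht ↦ ?_
  rw [uIcc_of_le hab] at ht
  have ht0 : 0 < t := ha.trans_le ht.1
  rw [Complex.re_ofReal_mul, mul_comm I, Complex.exp_ofReal_mul_I_re, Fejer.angS_eq_liZeroAngle ht0]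
  ring

/-- The amplitude piece: for `1 ≤ c`, `1 ≤ n`, with `s = √n`,
`|∫_s^{cs} cos(nθ) · ½ log(t/2π) dt| ≤ ((1 + 4c²)/2) (½ (log c + ½ log n + 2) + (c − 1)/2)`. -/
theorem abs_integral_cos_mul_log_le {c : ℝ} (hc : 1 ≤ c) {n : ℕ} (hn : 1 ≤ n) :
    |∫ t in Real.sqrt n..c * Real.sqrt n, Real.cos (n * liZeroAngle t) * (Real.log (t / (2 * π)) / 2)| ≤
      (1 + 4 * c ^ 2) / 2 * ((Real.log c + Real.log n / 2 + 2) / 2 + (c - 1) / 2) := by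
  have hn1 : (1 : ℝ) ≤ n := by exact_mod_cast hn
  set s := Real.sqrt n with hs
  have hs1 : 1 ≤ s := by rw [hs]; exact Real.one_le_sqrt.2 hn1
  have hs0 : 0 < s := by linarith
  have hss : s ^ 2 = n := by rw [hs, Real.sq_sqrt (by linarith)]
  have hab : s ≤ c * s := le_mul_of_one_le_left hs0.le hc
  have hπ := Real.pi_pos
  -- the amplitude `g = ½ log(t/2π)`, `g' = 1/(2t)`
  set g : ℝ → ℝ := fun t ↦ Real.log (t / (2 * π)) / 2 with hg
  set g' : ℝ → ℝ := fun t ↦ 1 / (2 * t) with hg'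
  have hgd : ∀ x ∈ Icc s (c * s), HasDerivAt g (g' x) x := by
    intro x hx
    have hx0 : 0 < x := hs0.trans_le hx.1
    have h1 : HasDerivAt (fun t : ℝ ↦ t / (2 * π)) (1 / (2 * π)) x := by
      simpa using (hasDerivAt_id x).div_const (2 * π)
    have h2 := (h1.log (by positivity)).div_const 2
    refine h2.congr_deriv ?_
    rw [hg']
    field_simp
  have hg'c : ContinuousOn g' (Icc s (c * s)) := by
    refine continuousOn_of_forall_continuousAt fun x hx ↦ ?_
    have hx0 : 0 < x := hs0.trans_le hx.1
    rw [hg']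
    exact continuousAt_const.div (continuousAt_const.mul continuousAt_id) (by positivity)
  have hgc : ContinuousOn g (Icc s (c * s)) := fun x hx ↦ (hgd x hx).continuousAt.continuousWithinAt
  -- the phase `φ = n ϑ`, `φ' = n ϑ' ≤ −4/(1 + 4c²)`, `φ'' = n ϑ'' ≥ 0`
  set lam : ℝ := 4 / (1 + 4 * c ^ 2) with hlam
  have hlam0 : 0 < lam := by positivity
  have hφg : ∀ x, HasDerivAt (fun t ↦ (n : ℝ) * Fejer.angS t) ((n : ℝ) * Fejer.angD1 x) x := fun x ↦
    (Fejer.hasDerivAt_angS x).const_mul _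
  have hφ' : ∀ x ∈ Icc s (c * s), HasDerivAt (fun t ↦ (n : ℝ) * Fejer.angD1 t) ((n : ℝ) * Fejer.angD2 x) x :=
    fun x _ ↦ (Fejer.hasDerivAt_angD1 x).const_mul _
  have hφ''c : ContinuousOn (fun t ↦ (n : ℝ) * Fejer.angD2 t) (Icc s (c * s)) :=
    (continuous_const.mul Fejer.continuous_angD2).continuousOn
  have hsign : (∀ x ∈ Icc s (c * s), 0 ≤ (n : ℝ) * Fejer.angD2 x) ∨
      (∀ x ∈ Icc s (c * s), (n : ℝ) * Fejer.angD2 x ≤ 0) :=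
    Or.inl fun x hx ↦ mul_nonneg n.cast_nonneg (Fejer.angD2_nonneg (hs0.le.trans hx.1))
  have hle : ∀ x ∈ Icc s (c * s), (n : ℝ) * Fejer.angD1 x ≤ -lam := by
    intro x hx
    have hu := Fejer.uS_pos x
    have hx2 : x ^ 2 ≤ c ^ 2 * n := by
      have := pow_le_pow_left₀ (hs0.le.trans hx.1) hx.2 2
      rw [mul_pow, hss] at this; exact this
    -- `n ϑ'(x) = −4n/(1 + 4x²) ≤ −4n/(1 + 4c²n) ≤ −4/(1 + 4c²)`
    have h1 : (n : ℝ) * Fejer.angD1 x = -(4 * n / Fejer.uS x) := by unfold Fejer.angD1; ring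
    rw [h1, hlam, neg_le_neg_iff, div_le_div_iff₀ (by positivity) hu]
    unfold Fejer.uS
    nlinarith
  have key := norm_integral_mul_exp_I_le_of_deriv_le hab hlam0 hφg hφ' hφ''c hsign hle hgd hg'c
  -- `|g(cs)| ≤ ½ (log c + ½ log n + 2)` and `∫ |g'| ≤ (c − 1)/2`
  have hl2π0 : 0 ≤ Real.log (2 * π) := Real.log_nonneg (by linarith [Real.pi_gt_three])
  have hl2π : Real.log (2 * π) ≤ 2 := by
    rw [Real.log_le_iff_le_exp (by positivity)]
    have he := Real.exp_one_gt_d9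
    have h4 : Real.exp 2 = Real.exp 1 * Real.exp 1 := by rw [← Real.exp_add]; norm_num
    rw [h4]; nlinarith [Real.pi_lt_d2]
  have hgb : |g (c * s)| ≤ (Real.log c + Real.log n / 2 + 2) / 2 := by
    rw [hg]
    dsimp only
    rw [Real.log_div (by positivity) (by positivity), Real.log_mul (by positivity) hs0.ne', hs,
      Real.log_sqrt (by positivity)]
    have hlc : 0 ≤ Real.log c := Real.log_nonneg hc
    have hln : 0 ≤ Real.log n := Real.log_nonneg hn1
    rw [abs_le]; constructor <;> linarith
  have hgi : ∫ x in s..c * s, |g' x| ≤ (c - 1) / 2 := by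
    have hpt : ∀ x ∈ Ι s (c * s), ‖|g' x|‖ ≤ 1 / (2 * s) := by
      intro x hx
      rw [uIoc_of_le hab] at hx
      have hx0 : 0 < x := hs0.trans hx.1
      rw [Real.norm_eq_abs, abs_abs, hg']
      dsimp only
      rw [abs_of_pos (by positivity)]
      exact one_div_le_one_div_of_le (by positivity) (by linarith [hx.1])
    have h := intervalIntegral.norm_integral_le_of_norm_le_const hpt
    rw [Real.norm_eq_abs, abs_of_nonneg (by linarith : (0 : ℝ) ≤ c * s - s)] at h
    calc ∫ x in s..c * s, |g' x| ≤ abs (∫ x in s..c * s, |g' x|) := le_abs_self _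
      _ ≤ 1 / (2 * s) * (c * s - s) := h
      _ = (c - 1) / 2 := by field_simp
  -- assemble
  rw [integral_cos_mul_eq_re n hs0 hab hgc]
  refine (Complex.abs_re_le_norm _).trans (key.trans ?_)
  have e : 2 / lam = (1 + 4 * c ^ 2) / 2 := by rw [hlam]; field_simp; norm_num
  rw [e]
  exact mul_le_mul_of_nonneg_left (add_le_add hgb hgi) (by positivity)

/-- The remainder piece: for `1 ≤ c`, `1 ≤ n`, `|∫_s^{cs} cos(nθ)(ϑ' − ½ log(t/2π))| ≤ 2(c − 1)`
(`|ϑ' − ½ log(t/2π)| ≤ 2/t ≤ 2/s` on a window of length `(c − 1)s`). -/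
theorem abs_integral_cos_mul_rem_le {c : ℝ} (hc : 1 ≤ c) {n : ℕ} (hn : 1 ≤ n) :
    |∫ t in Real.sqrt n..c * Real.sqrt n,
        Real.cos (n * liZeroAngle t) * (liGammaDensity t - Real.log (t / (2 * π)) / 2)| ≤ 2 * (c - 1) := by
  have hn1 : (1 : ℝ) ≤ n := by exact_mod_cast hn
  set s := Real.sqrt n with hs
  have hs1 : 1 ≤ s := by rw [hs]; exact Real.one_le_sqrt.2 hn1
  have hs0 : 0 < s := by linarith
  have hab : s ≤ c * s := le_mul_of_one_le_left hs0.le hc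
  have hpt : ∀ t ∈ Ι s (c * s),
      ‖Real.cos (n * liZeroAngle t) * (liGammaDensity t - Real.log (t / (2 * π)) / 2)‖ ≤ 2 / s := by
    intro t ht
    rw [uIoc_of_le hab] at ht
    have ht1 : 1 ≤ t := hs1.trans ht.1.le
    rw [Real.norm_eq_abs, abs_mul, WindowAdjust.liGammaDensity_eq]
    have h1 := Real.abs_cos_le_one (n * liZeroAngle t)
    have h2 := abs_riemannSiegelThetaDeriv_sub_log_le ht1
    have h3 : 2 / t ≤ 2 / s := div_le_div_of_nonneg_left (by norm_num) hs0 ht.1.le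
    calc |Real.cos (n * liZeroAngle t)| * |riemannSiegelThetaDeriv t - Real.log (t / (2 * π)) / 2|
        ≤ 1 * (2 / t) := mul_le_mul h1 h2 (abs_nonneg _) zero_le_one
      _ ≤ 2 / s := by rw [one_mul]; exact h3
  have h := intervalIntegral.norm_integral_le_of_norm_le_const hpt
  rw [Real.norm_eq_abs, abs_of_nonneg (by linarith : (0 : ℝ) ≤ c * s - s)] at h
  calc |∫ t in s..c * s, Real.cos (n * liZeroAngle t) * (liGammaDensity t - Real.log (t / (2 * π)) / 2)|
      ≤ 2 / s * (c * s - s) := h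
    _ = 2 * (c - 1) := by field_simp

end SmoothWindow

open SmoothWindow in
/-- **SMOOTH WINDOW BOUND (PART D companion `LiSmoothTraceWindowBound`) holds — RH-FREE:** for every `c ≥ 1` there is
`C` with `|(2/π)∫_{√n}^{c√n} cos(nθ(t)) ϑ'(t) dt| ≤ C log n` for all `n ≥ 2` (first-derivative test: phase `nθ`,
`|nθ'| ≥ 4/(1 + 4c²)`, amplitude `½ log(t/2π) + O(1/t)`). -/
theorem liSmoothTraceWindowBound_holds : LiSmoothTraceWindowBound := by
  intro c hc
  set K₀ : ℝ := (1 + 4 * c ^ 2) / 2 * ((Real.log c + 2) / 2 + (c - 1) / 2) + 2 * (c - 1) with hK₀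
  have hlc : 0 ≤ Real.log c := Real.log_nonneg hc
  have hK₀0 : 0 ≤ K₀ := by rw [hK₀]; positivity
  refine ⟨K₀ / Real.log 2 + (1 + 4 * c ^ 2) / 8, fun n hn ↦ ?_⟩
  have hn1 : 1 ≤ n := by omega
  have hn1' : (1 : ℝ) ≤ n := by exact_mod_cast hn1
  set s := Real.sqrt n with hs
  have hs1 : 1 ≤ s := by rw [hs]; exact Real.one_le_sqrt.2 hn1'
  have hs0 : 0 < s := by linarith
  have hab : s ≤ c * s := le_mul_of_one_le_left hs0.le hc
  have hℓ : 0 < Real.log 2 := Real.log_pos (by norm_num)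
  have hlog : Real.log 2 ≤ Real.log n := Real.log_le_log (by norm_num) (by exact_mod_cast hn)
  have hlog0 : 0 ≤ Real.log n := hℓ.le.trans hlog
  -- split the integrand
  set f₁ : ℝ → ℝ := fun t ↦ Real.cos (n * liZeroAngle t) * (Real.log (t / (2 * π)) / 2) with hf₁
  set f₂ : ℝ → ℝ := fun t ↦ Real.cos (n * liZeroAngle t) * (liGammaDensity t - Real.log (t / (2 * π)) / 2)
    with hf₂
  have hcont : ContinuousOn (fun t ↦ Real.cos (n * liZeroAngle t) * liGammaDensity t) (uIcc s (c * s)) :=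
    WindowAdjust.continuousOn_smooth_integrand n hs0 hab
  have hcos : ContinuousOn (fun t ↦ Real.cos (n * liZeroAngle t)) (uIcc s (c * s)) := by
    rw [uIcc_of_le hab]
    have hθ : ContinuousOn liZeroAngle (Icc s (c * s)) := fun t ht ↦
      (hasDerivAt_liZeroAngle (by linarith [ht.1] : t ≠ 0)).continuousAt.continuousWithinAt
    exact Real.continuous_cos.comp_continuousOn (continuousOn_const.mul hθ)
  have hlogc : ContinuousOn (fun t : ℝ ↦ Real.log (t / (2 * π)) / 2) (uIcc s (c * s)) := by
    rw [uIcc_of_le hab]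
    refine continuousOn_of_forall_continuousAt fun t ht ↦ ?_
    have ht0 : 0 < t := hs0.trans_le ht.1
    exact ((Real.continuousAt_log (by positivity)).comp
      (continuous_id.div_const _).continuousAt).div_const _
  have i1 : IntervalIntegrable f₁ volume s (c * s) := (hcos.mul hlogc).intervalIntegrable
  have i2 : IntervalIntegrable f₂ volume s (c * s) := by
    have : f₂ = fun t ↦ Real.cos (n * liZeroAngle t) * liGammaDensity t - f₁ t := by
      funext t; simp only [hf₂, hf₁]; ring
    rw [this]
    exact hcont.intervalIntegrable.sub i1
  have hsplit : ∫ t in s..c * s, Real.cos (n * liZeroAngle t) * liGammaDensity t =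
      (∫ t in s..c * s, f₁ t) + ∫ t in s..c * s, f₂ t := by
    rw [← intervalIntegral.integral_add i1 i2]
    refine intervalIntegral.integral_congr fun t _ ↦ ?_
    simp only [hf₁, hf₂]; ring
  have b1 := abs_integral_cos_mul_log_le hc hn1
  have b2 := abs_integral_cos_mul_rem_le hc hn1
  have hπ : 2 / Real.pi ≤ 1 := by rw [div_le_one Real.pi_pos]; linarith [Real.pi_gt_three]
  unfold liSmoothTraceWindow
  rw [hsplit, abs_mul, abs_of_pos (by positivity : (0 : ℝ) < 2 / Real.pi)]
  have hsum : |(∫ t in s..c * s, f₁ t) + ∫ t in s..c * s, f₂ t| ≤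
      K₀ + (1 + 4 * c ^ 2) / 8 * Real.log n := by
    refine (abs_add_le _ _).trans ?_
    have := add_le_add b1 b2
    have e : (1 + 4 * c ^ 2) / 2 * ((Real.log c + Real.log n / 2 + 2) / 2 + (c - 1) / 2) + 2 * (c - 1)
        = K₀ + (1 + 4 * c ^ 2) / 8 * Real.log n := by rw [hK₀]; ring
    linarith
  have hK : K₀ ≤ K₀ / Real.log 2 * Real.log n := by
    rw [div_mul_eq_mul_div, le_div_iff₀ hℓ]
    exact mul_le_mul_of_nonneg_left hlog hK₀0
  calc 2 / Real.pi * |(∫ t in s..c * s, f₁ t) + ∫ t in s..c * s, f₂ t|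
      ≤ 1 * (K₀ + (1 + 4 * c ^ 2) / 8 * Real.log n) := mul_le_mul hπ hsum (abs_nonneg _) zero_le_one
    _ ≤ (K₀ / Real.log 2 + (1 + 4 * c ^ 2) / 8) * Real.log n := by linarith

end Summit.RiemannHypothesis.RiemannHypothesis.Theorems.LiTheory

end
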